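import Mathlib
import Summits.Ventures.PercRepro2.Defs
import Summits.Ventures.PercRepro2.Independence
import Summits.Ventures.PercRepro2.Harris
import Summits.Ventures.PercRepro2.Graph
import Summits.Ventures.PercRepro2.Events
import Summits.Ventures.PercRepro2.ZCZeroWeight

/-!
# Zero-weight edges may be re-routed (blind cell PercRepro2, mine-a g24; MINE-A.md §72.8)

Two endpoint maps `ends`, `ends'` that agree off a set `Z` of edges give the same connection and cluster
events on every configuration in which the edges of `Z` are closed (`conn_congr_of_closed`,
`cluster_congr_of_closed`); if the weights vanish on `Z`, every probability of such an event is the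
same for `ends` and `ends'` (`prob_congr_of_closed` via `prob_eq_closeSet`), and so is the whole (ZC)
expression (`zc_expr_congr`).  Consequence: a graph theorem whose hypothesis is «the vertex `v` has
exactly the edges `f₁`, `f₂`» applies under the weaker hypothesis «every other edge at `v` has weight
`0`» — re-route the zero-weight edges at `v` into a loop at another vertex.  This is what lets the
degree-two reductions compose in the kernel (`ZCInsertP.lean`).  No definition; one seat.
-/

namespace Summit.Ventures.PercRepro2

section Reroute

variable {V : Type*} {E : Type*}

/-- On a configuration in which the edges of `Z` are closed, endpoint maps agreeing off `Z` give the
same open graph. -/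
lemma openGraph_congr_of_closed {ends ends' : E → Sym2 V} {Z : Set E}
    (hends : ∀ e, e ∉ Z → ends e = ends' e) {ω : Config E} (hω : ∀ e ∈ Z, ω e = false) :
    openGraph ends ω = openGraph ends' ω := by
  ext u v
  rw [openGraph_adj, openGraph_adj]
  constructor
  · rintro ⟨hne, e, he, h⟩
    have heZ : e ∉ Z := fun hZ => by rw [hω e hZ] at he; exact Bool.false_ne_true he
    exact ⟨hne, e, he, by rw [← hends e heZ]; exact h⟩
  · rintro ⟨hne, e, he, h⟩
    have heZ : e ∉ Z := fun hZ => by rw [hω e hZ] at he; exact Bool.false_ne_true he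
    exact ⟨hne, e, he, by rw [hends e heZ]; exact h⟩

/-- Connections agree when the re-routed edges are closed. -/
lemma conn_congr_of_closed {ends ends' : E → Sym2 V} {Z : Set E}
    (hends : ∀ e, e ∉ Z → ends e = ends' e) {ω : Config E} (hω : ∀ e ∈ Z, ω e = false) (u v : V) :
    Conn ends ω u v ↔ Conn ends' ω u v := by
  unfold Conn
  rw [openGraph_congr_of_closed hends hω]

/-- Clusters agree when the re-routed edges are closed. -/
lemma cluster_congr_of_closed {ends ends' : E → Sym2 V} {Z : Set E}
    (hends : ∀ e, e ∉ Z → ends e = ends' e) {ω : Config E} (hω : ∀ e ∈ Z, ω e = false) (u : V) :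
    cluster ends ω u = cluster ends' ω u := by
  ext v
  exact conn_congr_of_closed hends hω u v

variable [Fintype E] [DecidableEq E] {R : Type*} [CommRing R]

/-- Events that agree on the configurations closed on a zero-weight set `Z` have the same probability. -/
lemma prob_congr_of_closed (p : E → R) (Z : Finset E) (hZ : ∀ e ∈ Z, p e = 0)
    {A A' : Set (Config E)} (h : ∀ ω : Config E, (∀ e ∈ Z, ω e = false) → (ω ∈ A ↔ ω ∈ A')) :
    prob p A = prob p A' := by
  rw [prob_eq_closeSet p Z hZ A, prob_eq_closeSet p Z hZ A']
  congr 1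
  ext ω
  simp only [Set.mem_setOf_eq]
  exact h _ (fun e he => closeSet_apply_of_mem Z ω he)

/-- **The (ZC) expression is unchanged by re-routing zero-weight edges.** -/
lemma zc_expr_congr (p : E → R) (Z : Finset E) (hZ : ∀ e ∈ Z, p e = 0)
    {ends ends' : E → Sym2 V} (hends : ∀ e, e ∉ Z → ends e = ends' e) (a₁ a₃ o : V)
    (𝓔 : Set (Set V)) :
    let e := connEvent ends a₁ a₃
    let L := connEvent ends a₁ o
    let U := clusterInEvent ends a₁ 𝓔
    let γ := connEvent ends a₃ o
    let e' := connEvent ends' a₁ a₃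
    let L' := connEvent ends' a₁ o
    let U' := clusterInEvent ends' a₁ 𝓔
    let γ' := connEvent ends' a₃ o
    prob p (eᶜ ∩ Lᶜ ∩ γᶜ) * (prob p (U ∩ (e ∩ L)) - prob p U * prob p (e ∩ L))
      - prob p (eᶜ ∩ Lᶜ ∩ γ) * (prob p (U ∩ (e ∩ Lᶜ)) - prob p U * prob p (e ∩ Lᶜ))
    = prob p (e'ᶜ ∩ L'ᶜ ∩ γ'ᶜ) * (prob p (U' ∩ (e' ∩ L')) - prob p U' * prob p (e' ∩ L'))
      - prob p (e'ᶜ ∩ L'ᶜ ∩ γ') * (prob p (U' ∩ (e' ∩ L'ᶜ)) - prob p U' * prob p (e' ∩ L'ᶜ)) := by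
  intro e L U γ e' L' U' γ'
  have hZ' : ∀ e, e ∉ (Z : Set E) → ends e = ends' e := fun e he => hends e (by simpa using he)
  have ce : ∀ ω : Config E, (∀ e ∈ Z, ω e = false) → (ω ∈ e ↔ ω ∈ e') := fun ω hω =>
    conn_congr_of_closed hZ' (fun e he => hω e (by simpa using he)) a₁ a₃
  have cL : ∀ ω : Config E, (∀ e ∈ Z, ω e = false) → (ω ∈ L ↔ ω ∈ L') := fun ω hω =>
    conn_congr_of_closed hZ' (fun e he => hω e (by simpa using he)) a₁ o
  have cγ : ∀ ω : Config E, (∀ e ∈ Z, ω e = false) → (ω ∈ γ ↔ ω ∈ γ') := fun ω hω =>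
    conn_congr_of_closed hZ' (fun e he => hω e (by simpa using he)) a₃ o
  have cU : ∀ ω : Config E, (∀ e ∈ Z, ω e = false) → (ω ∈ U ↔ ω ∈ U') := fun ω hω => by
    show cluster ends ω a₁ ∈ 𝓔 ↔ cluster ends' ω a₁ ∈ 𝓔
    rw [cluster_congr_of_closed hZ' (fun e he => hω e (by simpa using he)) a₁]
  have h1 := prob_congr_of_closed p Z hZ (A := eᶜ ∩ Lᶜ ∩ γᶜ) (A' := e'ᶜ ∩ L'ᶜ ∩ γ'ᶜ) (fun ω hω => by
    simp only [Set.mem_inter_iff, Set.mem_compl_iff, ce ω hω, cL ω hω, cγ ω hω])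
  have h2 := prob_congr_of_closed p Z hZ (A := U ∩ (e ∩ L)) (A' := U' ∩ (e' ∩ L')) (fun ω hω => by
    simp only [Set.mem_inter_iff, cU ω hω, ce ω hω, cL ω hω])
  have h3 := prob_congr_of_closed p Z hZ (A := U) (A' := U') (fun ω hω => cU ω hω)
  have h4 := prob_congr_of_closed p Z hZ (A := e ∩ L) (A' := e' ∩ L') (fun ω hω => by
    simp only [Set.mem_inter_iff, ce ω hω, cL ω hω])
  have h5 := prob_congr_of_closed p Z hZ (A := eᶜ ∩ Lᶜ ∩ γ) (A' := e'ᶜ ∩ L'ᶜ ∩ γ') (fun ω hω => by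
    simp only [Set.mem_inter_iff, Set.mem_compl_iff, ce ω hω, cL ω hω, cγ ω hω])
  have h6 := prob_congr_of_closed p Z hZ (A := U ∩ (e ∩ Lᶜ)) (A' := U' ∩ (e' ∩ L'ᶜ)) (fun ω hω => by
    simp only [Set.mem_inter_iff, Set.mem_compl_iff, cU ω hω, ce ω hω, cL ω hω])
  have h7 := prob_congr_of_closed p Z hZ (A := e ∩ Lᶜ) (A' := e' ∩ L'ᶜ) (fun ω hω => by
    simp only [Set.mem_inter_iff, Set.mem_compl_iff, ce ω hω, cL ω hω])
  rw [h1, h2, h3, h4, h5, h6, h7]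

end Reroute

end Summit.Ventures.PercRepro2
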